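import Mathlib.Analysis.Calculus.ContDiff.Basic
import Literature.Analysis.FluidPDE.NSWave0
import Literature.Analysis.FluidPDE.LerayHopf
import Literature.Analysis.FluidPDE.NSLerayHopf
import HarnessLib
import HarnessLib.Audit
import HarnessLib.Audit.TribunalTags

/-!
# Strong-Hypothesis Library — summit `NavierStokesRegularity` (D-0034, skeleton)

The REGISTRY of known strong hypotheses `H` (open statements with `H ⇒ P` landed or printed) and
of known EQUIVALENT REFORMULATIONS `E` (`E ↔ P` landed) for the single-problem summit
`NavierStokesRegularity`. Every registered entry carries
`@[strong_hypothesis "NavierStokesRegularity.NavierStokesRegularity"]`; the kernel tribunal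
(`#h21_tribunal`, D-0033 T1 rule (a)) probes each registered `H` against a route crux `C` for
`H → C`. The bridges live summit-side in `Summits/NavierStokesRegularity/StrongHypotheses.lean`.
SKELETON pass: two newly stated hypotheses here, one summit-side equivalent criterion tagged in the
summit file, and a census of the candidates not yet in the tree.

## The problem

* `NavierStokesRegularity : Prop := Literature.NS.NavierStokesExistenceSmoothR3`
  (`Summits/NavierStokesRegularity/NavierStokesRegularity/Statement.lean`) — Fefferman's Clay
  statement **(A)**: for every `ν > 0` and every smooth divergence-free `u₀ : ℝ³ → ℝ³` with rapid
  decay of all derivatives (4), the UNFORCED system (`f ≡ 0`) has a solution `(u, p)` smooth on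
  `ℝ³ × [0, ∞)` (6) with bounded energy (7). Whole space `ℝ³`, not the torus; existence and
  smoothness, not breakdown. Vocabulary: `Literature/Analysis/FluidPDE/NSWave0.lean`
  (`IsNavierStokesSolution`, `IsSmoothOnHalfSpace`, `HasRapidSpatialDecay`,
  `HasRapidSpaceTimeDecay`, `HasBoundedEnergy`).

## Census (relation legend: "strictly stronger" = `H ⇒ P` known, `P ⇒ H` not known in print;
"equivalent" = `H ↔ P` landed or printed; "partial" = `H` settles only a sub-case of `P`)

| # | `H` / `E` | one-line statement | relation | source | status here | bridge |
|---|---|---|---|---|---|---|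
| 1 | `NavierStokesExistenceSmoothForcedR3` | Clay (A) WITH a force of Clay class (5): for every `ν > 0`, every Clay datum and every smooth rapidly decaying force there is a Clay-class solution — i.e. Clay statement (C) FAILS at every `ν` | strictly stronger (Tao 2013, after Prop. 1.7: no implication homogeneous ⇒ inhomogeneous is known on `ℝ³`) | Tao 2013, Conj. 1.5 ("Global regularity for Schwartz data", finite horizons, `ν = 1`); Fefferman 2000/2006, statement (C) | NEW (stated here), registered | landed: `Summit.NavierStokesRegularity.StrongHypotheses.forcedR3_implies_navierStokesRegularity` (take `f = 0`) |
| 2 | `LerayHopfLThreeBound` | every Leray–Hopf weak solution of the unforced system on `ℝ³ × [0,T)` from a Clay datum lies in `L^∞(0,T; L³(ℝ³))` | stronger, in substance equivalent (`H ⇒ P`: Escauriaza–Seregin–Šverák 2003 Thm. 1.4 + Leray 1934 + local theory; `P ⇒ H`: Kato's `C_t L³` theory + weak–strong uniqueness — folklore, not landed) | ESS 2003, Thms. 1.3–1.4; Seregin 2012, Thm. 1.1 (blow-up ⇔ `‖u(t)‖_{L³} → ∞`) | NEW (stated here), registered | printed: `Summit.NavierStokesRegularity.StrongHypotheses.LerayHopfLThreeBoundImpliesNavierStokesRegularity`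 |
| 3 | `Summit.NavierStokesRegularity.NavierStokesRegularity.Cruxes.FluxZoom.Disproof.NoBlowup` | no finite-time blow-up: every classical solution of the unforced system on `[0,T)`, Leray–Hopf on `[0,T]` from a rapidly decaying datum, extends smoothly past `T` | equivalent (landed `navierStokesRegularity_iff_noBlowup`, in-tree proof over Leray 1934, Kato 1984, Prodi–Serrin, Lemarié-Rieusset 2016 Thm. 15.1) | folklore blow-up reformulation of (A) (Fefferman p. 2 "blowup time"; Tao 2013 §1) | existing summit-side closed `Prop` (built `Cruxes` module), registered IN THE SUMMIT FILE | landed: `Summit.NavierStokesRegularity.StrongHypotheses.noBlowup_iff_navierStokesRegularity` |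
| 4 | Ladyzhenskaya–Prodi–Serrin CLASS hypothesis | every Leray–Hopf solution from a Clay datum lies in some `L^q(0,T; L^r)`, `2/q + 3/r ≤ 1`, `3 < r ≤ ∞` | strictly stronger | Prodi 1959; Serrin 1962/1963; Ladyzhenskaya 1967 (the CRITERION is a theorem: in tree `Literature.Analysis.FluidPDE.ladyzhenskaya_prodi_serrin`, discharged `…_holds`; the HYPOTHESIS "all solutions are in the class" is open) | candidate (not yet in tree; typeable in ~10 lines with `MemLqLp`, as row 2) | would be printed (LPS theorem + Leray + `NoBlowup ↔ (A)`) |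
| 5 | periodic `H¹` global well-posedness WITH forcing | Tao's Conj. 1.9: every periodic `H¹` set of data `(u₀, f, T, L)`, `f ∈ L^∞_t H¹_x`, has a periodic `H¹` mild solution | strictly stronger | Tao 2013, Conj. 1.9; `⇒ (A)` is Thm. 1.20 (iii)+(iv) (1.9 ⇒ 1.19 ⇔ 1.18 ⇒ 1.5 ⇒ 1.3) | candidate (not yet in tree: torus Leray–Hopf vocabulary `Literature.Analysis.FluidPDE.Torus.IsLerayHopfOn` exists, the periodic `H¹`-MILD class with `L^∞_t H¹_x` forcing and normalised pressure does not) | would be printed (Tao 2013 Thm. 1.20) |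
| 6 | `H¹` mild global well-posedness on `ℝ³` from spatially smooth Schwartz / `H¹` data with forcing | Tao's Conj. 1.18 ⇔ 1.19 | strictly stronger | Tao 2013, Conj. 1.18/1.19; `⇒ (A)` is Thm. 1.20 (iv) | candidate (not yet in tree as a closed `Prop`; `ℝ³` `H¹` vocabulary partly exists: `TaoH1LocalExistence`, `NSSerrinRegularityProofs.TaoH1AlmostRegularWith`) | would be printed |
| 7 | Beale–Kato–Majda-type hypothesis | for every classical Leray–Hopf solution from a Clay datum, `∫₀^T ‖curl u(t)‖_∞ dt < ∞` for all finite `T` | strictly stronger | Beale–Kato–Majda 1984 (Euler; the Navier–Stokes criterion is folklore / Kozono–Taniuchi 2000) | candidate (typeable: `Literature.Analysis.FluidPDE.curl`, `eLpNorm`) | would be printed |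
| 8 | Constantin–Fefferman direction-coherence hypothesis | the vorticity direction of every classical solution from a Clay datum is Lipschitz-coherent in regions of high vorticity | strictly stronger | Constantin–Fefferman 1993 (criterion a theorem; in tree `ConstantinFeffermanHolds.lean`) | candidate (typeable over the tree's `ConstantinFeffermanStretching` vocabulary) | would be printed |
| 9 | full interior regularity of suitable weak solutions | every suitable weak solution (CKN sense) of the unforced system on `ℝ³ × (0,T)` is smooth in the interior | strictly stronger (CKN 1982 prove only `𝒫¹(Sing) = 0`) | Caffarelli–Kohn–Nirenberg 1982; Scheffer | candidate (typeable: `Literature.Analysis.FluidPDE.IsSuitableWeakSolutionOn`) | would be printed (CKN existence of a suitable Leray–Hopf solution + weak–strong uniqueness + `NoBlowup ↔ (A)`) |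

## Deliberately NOT registered (and why)

* Clay **(B)** `Summit.NavierStokesRegularity.NavierStokesRegularity.NavierStokesExistenceSmoothPeriodic`
  (transitional copy `Literature.Analysis.FluidPDE.NavierStokesExistenceSmoothPeriodic`; Tao's
  Conj. 1.4): RELATED, NOT KNOWN TO IMPLY (A). Tao 2013 Thm. 1.20 derives (A) (his Conj. 1.3) only
  from the FORCED periodic `H¹` conjecture 1.9 (row 5); from the homogeneous periodic statement
  nothing flows to (A) in print ("we were unable to obtain this converse implication in the
  inhomogeneous case", after Thm. 1.20; Rem. 1.22: CKN gives 1.19 ⇒ 1.8, again not from (B)).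
  The route `Theses/PeriodicPortability` carries the missing transplant step as its crux. Not tagged.
* Clay **(C)**, **(D)** (`…NavierStokesBreakdownR3`, `…NavierStokesBreakdownPeriodic`): breakdown
  statements. `¬ (C)` (at ONE `ν`) implies (A) only after the `ν`-scaling remark; the uniform
  negation "(C) fails at every `ν`" IS row 1, stated positively (`not_navierStokesBreakdownR3_of_forcedR3`).
* Liouville-type conjectures — `…LiouvilleConjectureNS` (KNSS 2009 (L): bounded ancient mild
  solutions are constant), `…TypeIDSSLiouvilleConjecture` (Tsai, Conj. 8.8–8.9),
  `…AxisymmetricLiouvilleBoundedSwirl` (AX-L): PARTIAL — each excludes only TYPE I blow-up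
  (Koch–Nadirashvili–Seregin–Šverák 2009 §1; Seregin–Šverák 2009), not Type II; no `H ⇒ (A)` in
  print. Likewise the negations of the registered open existence questions
  `Literature.Analysis.FluidPDE.TypeISingularityExists`, `…LocalTypeISingularityExists`,
  `…NontrivialTypeIAncientExists`, `…NontrivialMildAncientTypeIExists`,
  `Summit.….Cruxes.SequentialTypeIExclusion.Lines.SereginTypeIBlowupExists` (Type I only). Not tagged.
* `…AxisymmetricSwirlRegularity` (global regularity for axisymmetric data with swirl): WEAKER —
  the axisymmetric special case of (A). Not tagged.
* Uniqueness / non-uniqueness of Leray–Hopf solutions (`Literature.Analysis.FluidPDE.LerayHopfNonUniqueness`,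
  `…EnergyClassNonUniqueness`; Jia–Šverák 2015, Buckmaster–Vicol 2019 Problem 9): RELATED, neither
  stronger nor weaker — uniqueness of Leray–Hopf solutions does not imply their regularity in print,
  and non-uniqueness is compatible with (A). Not tagged.
* `Literature.Analysis.FluidPDE.RusinSverakQuestion` (minimal blow-up datum in `Ḣ^{1/2} ∩ L²` IF
  `ρ_max < ∞`): conditional on the FAILURE of global regularity, hence vacuous under (A). Not tagged.
* Regularity CRITERIA that are THEOREMS (named facts, several discharged) — never hypotheses:
  `ladyzhenskaya_prodi_serrin`, `weak_strong_uniqueness`, `ess_endpoint`, `seregin_L3_blowup`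
  (`NSLerayHopf.lean`), CKN ε-regularity (`CKNEpsilonRegularity*.lean`), Constantin–Fefferman
  (`ConstantinFeffermanHolds.lean`), Cheskidov–Shvydkoy (`CheskidovShvydkoyRegular.lean`), the
  axisymmetric-no-swirl theorem (`AxisymmetricNoSwirlGlobalHolds.lean`). Their "the hypothesis holds
  for every solution" strengthenings are rows 2, 4, 7, 8, 9.
* ROUTE CRITERIA (`Theses` decls with landed `… ↔ NavierStokesRegularity`, e.g.
  `TautLoopKelvin.TautCompressionIntegrable`, `HodographBetchov.FastClassSqueeze/SlowClassProduction`,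
  the several route-local `NoBlowup` frame items): cruxes, found by the tribunal's own scan of
  `Summits/…/Theorems`; never tagged here (tagging them is circular). Row 3 tags the ONE copy that
  lives in a `Cruxes` module together with its landed `↔`.

## Not yet typeable

None of the census rows is blocked by missing notions; rows 5–6 need a new solution CLASS
(periodic / whole-space `H¹` mild solutions with `L^∞_t H¹_x` forcing and normalised pressure,
Tao 2013 §1), which is routine vocabulary, not a missing theory.

## Sources (keys in `lean/references.bib`)

[FeffermanClay2006] statements (A)–(D), eqs. (1)–(11); [Tao2013Localisation] §1: Conj. 1.3–1.6,
Prop. 1.7, Conj. 1.8–1.10, 1.13–1.19, Thm. 1.20, Rem. 1.21–1.22 (arXiv:1108.1165 numbering = journal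
numbering minus the leading "1."); [EscauriazaSereginSverak2003] Thms. 1.3–1.4; [Seregin2012] Thm. 1.1;
[Prodi1959]; [Serrin1962]; [Serrin1963]; [Leray1934] Ch. V §31; [Kato1984] Thms. 1–4;
[RobinsonRodrigoSadowski2016] Thms. 8.17, 8.19, 16.4; [KochNadirashviliSereginSverak2009] §1;
[SereginSverak2009]; [CKN1982]; [BealeKatoMajda1984]; [ConstantinFefferman1993];
[LemarieRieusset2016] Thm. 15.1.

## Design notes

* Row 1 is written with FEFFERMAN's data/force classes on the whole half-line `[0, ∞)` (force
  smooth on `ℝ³ × [0,∞)` with space-time rapid decay (5), solution of Clay class (6)–(7)), i.e. it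
  is literally `∀ ν > 0, ¬ (body of Clay (C) at ν)` turned positive; Tao's Conj. 1.5 is the same
  assertion on finite horizons `[0, T]` at `ν = 1` with the force Schwartz on `[0, T]`. The `f = 0`
  slice is (A) on the nose (`HasRapidSpaceTimeDecay 0`, `IsSmoothOnHalfSpace 0` hold trivially),
  so the bridge is LANDED summit-side.
* Row 2 quantifies over ALL Leray–Hopf weak solutions (`IsLerayHopfOn T ν 0 u₀ u`, the tree's
  Leray–Hopf class on `ℝ³ × [0, T)`) from a Clay datum and asks the ESS endpoint class
  `MemLqLp ∞ 3 u (Ioo 0 T)` = `u ∈ L^∞(0,T; L³)`, exactly the hypothesis of the tree's named fact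
  `ess_endpoint`; the datum class is Clay's (smooth, divergence-free, rapidly decaying), so the
  statement speaks about the summit's data and nothing more.
-/

noncomputable section

open scoped ContDiff ENNReal
open MeasureTheory Set

namespace Literature.StrongHypotheses.NavierStokesRegularity

open Literature.Analysis.FluidPDE

/-- Euclidean 3-space. -/
local notation "ℝ³" => EuclideanSpace ℝ (Fin 3)

/-! ## Strictly stronger, newly stated -/

/-- OPEN CONJECTURE — **global regularity for Schwartz data WITH forcing** (T. Tao, *Localisation
and compactness properties of the Navier–Stokes global regularity problem*, Anal. PDE 6 (2013),
Conj. 1.5 "Global regularity for Schwartz data": "Let `(u₀, f, T)` be a Schwartz set of data. Then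
there exists a smooth finite energy solution `(u, p, u₀, f, T)` with the indicated data"; posed
there as the natural inhomogeneous extension of Clay (A) = his Conj. 1.3, and singled out by
Fefferman's Clay statement (C), of which it is the negation at every viscosity). Stated in
Fefferman's global-in-time classes: for every `ν > 0`, every smooth divergence-free datum `u₀`
with rapid spatial decay (4) and every force `f` smooth on `ℝ³ × [0, ∞)` with space-time rapid
decay (5), there is `(u, p)` smooth on `ℝ³ × [0, ∞)` (6) solving (1)–(3) with force `f` and datum
`u₀`, with bounded energy (7). STRICTLY STRONGER than the summit: `f = 0` gives (A) (bridge LANDED,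
summit file); no implication (A) ⇒ this is known ("this is the only implication we know of that
can deduce a global regularity result for the inhomogeneous Navier–Stokes problem from a global
regularity result for the homogeneous Navier–Stokes problem", Tao 2013 after Prop. 1.7, about the
periodic Galilean loophole only). Open. [cite: Tao2013Localisation, Conj. 1.5] [status: open] -/
@[conjecture, strong_hypothesis "NavierStokesRegularity.NavierStokesRegularity"]
def NavierStokesExistenceSmoothForcedR3 : Prop :=
  ∀ ν : ℝ, 0 < ν → ∀ (u₀ : ℝ³ → ℝ³) (f : ℝ → ℝ³ → ℝ³),
    ContDiff ℝ ∞ u₀ → NSWave0.IsDivFree u₀ → HasRapidSpatialDecay u₀ →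
    IsSmoothOnHalfSpace f → HasRapidSpaceTimeDecay f →
      ∃ (u : ℝ → ℝ³ → ℝ³) (p : ℝ → ℝ³ → ℝ),
        IsSmoothOnHalfSpace u ∧ IsSmoothOnHalfSpace p ∧
          IsNavierStokesSolution ν f u₀ u p ∧ HasBoundedEnergy u

/-- The forced hypothesis refutes Clay (C) (`NavierStokesBreakdownR3`: at every `ν` SOME Clay
datum and force admit no Clay-class solution): instantiate at `ν = 1`. [cite: FeffermanClay2006, statement (C)] -/
theorem not_navierStokesBreakdownR3_of_forcedR3 (h : NavierStokesExistenceSmoothForcedR3) :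
    ¬ NavierStokesBreakdownR3 := by
  intro hC
  obtain ⟨u₀, f, hs, hd, hdec, hf, hfd, hno⟩ := hC 1 one_pos
  exact hno (h 1 one_pos u₀ f hs hd hdec hf hfd)

/-- OPEN CONJECTURE — **the critical `L³` bound for Leray–Hopf solutions** (the hypothesis of the
Escauriaza–Seregin–Šverák endpoint criterion asserted for ALL solutions): for every `ν > 0`, every
`T > 0`, every Clay datum `u₀` (smooth, divergence-free, rapidly decaying) and every Leray–Hopf weak
solution `u` of the unforced system on `ℝ³ × [0, T)` from `u₀`, one has `u ∈ L^∞(0, T; L³(ℝ³))`.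
By ESS 2003, Thm. 1.4 ("`L_{3,∞}`-solutions of the Navier–Stokes equations are smooth"; in tree the
named fact `Literature.Analysis.FluidPDE.ess_endpoint`) and Seregin 2012, Thm. 1.1 (at a first
blow-up time `‖u(t)‖_{L³} → ∞`; `seregin_L3_blowup`) such solutions are smooth and unique, so with
Leray's global existence this hypothesis implies (A) — bridge PRINTED (summit file). Conversely (A)
gives it in substance (Kato's global `C_t L³_x` solution + weak–strong uniqueness), a folklore
argument not landed; registered as stronger-or-equivalent. Open (it is the modern critical-norm
form of the regularity problem, ESS 2003 §1). [cite: EscauriazaSereginSverak2003, Thms. 1.3–1.4] [status: open] -/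
@[conjecture, strong_hypothesis "NavierStokesRegularity.NavierStokesRegularity"]
def LerayHopfLThreeBound : Prop :=
  ∀ (ν T : ℝ), 0 < ν → 0 < T → ∀ (u₀ : ℝ³ → ℝ³) (u : ℝ → ℝ³ → ℝ³),
    ContDiff ℝ ∞ u₀ → NSWave0.IsDivFree u₀ → HasRapidSpatialDecay u₀ →
    IsLerayHopfOn T ν 0 u₀ u → MemLqLp ∞ 3 u (Ioo 0 T)

end Literature.StrongHypotheses.NavierStokesRegularity
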